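import Literature.MathematicalPhysics.QuantumFieldTheory.Balaban1983to89.B9

/-!
# `Balaban1983to89.B9SectBStepReadingMaps` — the Theorem-3.1∕3.3 blocks and the Sect.-B step `B9.SectBStepPrinted` under a CHANGE OF READING:
# pull-back of a `B9.Geometry` and of its kernel families along a site map `φ : S → 𝔅`, restriction, the converse on `range φ`, the
# «orphan law» for the sites off `range φ`, and the two-geometry family transfer

T. Bałaban, *Propagators for lattice gauge theories in a background field*, Commun. Math. Phys. **99** (1985) 389–434
[`Balaban1985BackgroundPropagators`, "B9"], Thm 3.1 (3.42)–(3.47) pp. 397–398 (*"for x ∈ Δ(y), y ∈ Λ_j, supp λ ⊂ Δ(y′) … Here y, y′ ∈ 𝔅 =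
⋃_j Λ_j"*), Thm 3.2 (3.48) p. 398, Sect. B pp. 400–407; T. Bałaban, *Propagators and renormalization transformations for lattice gauge theories. II*,
Commun. Math. Phys. **96** (1984) 223–250 [`Balaban1984PropagatorsII`, "[4]"], (2.3)–(2.4) p. 224, (2.45)–(2.46) p. 231 (𝔅, the blocks, the bonds Λ_j).

statement-level skeleton of published theorems with citation tags; proofs where landed; nothing here is a claim about the
Yang–Mills mass gap

THE POINT (cell `pub-ymgap`, Track A node N06 [B9], row 13 of the N06 certificate = the Sect.-B step; seat `pub-ymgap-dag-n06-c` gen 10, LOCATED-8).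
Print states (3.42)–(3.48) for ALL localisation sites `y, y′ ∈ 𝔅`.  A typed reading may index the same quantities by another site type `S` through a
map `φ : S → 𝔅` (NODE 00's reading of record indexes by the INDEX BONDS of [4] (2.3) and localises at the carrier block `β b`; at a member with an
inner corner `β` is not onto 𝔅 — the ORPHAN blocks).  This file is the generic bookkeeping of such a change of reading:
* §1 `comapGeo g φ` — the geometry `g` re-indexed by `S` (sites `S`; `scale`, `dist`, the support and cut-off predicates read through `φ`; every norm
  functional shared), `comapK K φ` ∕ `comapSK C φ` — a kernel family ∕ a two-point kernel re-indexed the same way;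
* §2 RESTRICTION: each block of Theorems 3.1–3.3 for `(g, K)` gives the block for `(comapGeo g φ, comapK K φ)` with the SAME constants;
* §3 THE CONVERSE: from the pulled-back block one recovers the block of `(g, K)` on the site pairs inside `range φ`; the pairs with an end OFF
  `range φ` are a separate Prop (`…Off`, the «orphan law» shape); both together give the block back (`thms31to33IneqAt_of_comap_of_off`); when `φ` is
  onto, the orphan law is vacuous;
* §4 the Sect.-B step TRANSFERS between two readings on two geometries with the same `M`-field (`sectBStepPrinted_of_readings`: input domination at
  regular `U` from reading 2 to reading 1, output domination at the products `U′U` from 1 to 2 — `B9SectBStepFamilyTransfer.sectBStepPrinted_of_family`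
  is the one-geometry diagonal), and RESTRICTS along any map of member indices;
* §5 COROLLARIES: the step for `(g, K)` plus the displayed LIFT LAW «blocks of the pulled-back reading at regular `U` ⟹ blocks of the reading» gives
  the step for the pulled-back reading; no law when every `φ` is onto.

HONEST SCOPE.  Quantifier and reading bookkeeping over `B9.lean`'s typed predicates; nothing of [B9] is asserted; no constant of print is computed;
COUNT-NEUTRAL; N06 NOT discharged; one finite lattice programme — nothing continuum, nothing about OS positivity or the mass gap.  2026-08-28.
-/

namespace Literature.MathematicalPhysics.QuantumFieldTheory.Balaban1983to89.B9SectBStepReadingMaps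

open Literature.MathematicalPhysics.QuantumFieldTheory.Balaban1983to89.B9
  (Geometry Backgrounds KernelFamily SiteKernel Ineq342_346_347 Ineq343_345 Thms31to33IneqAt SectBStepPrinted pref4 pref6)

/-! ## §1 Readings pulled back along a site map -/

section Comap

variable (g : Geometry) {S : Type} (φ : S → g.Site)

/-- **THE GEOMETRY RE-INDEXED BY `S` ALONG `φ : S → 𝔅`**: sites `S`; the scale, the distance and the four support ∕ cut-off predicates read at the
image site `φ a`; the argument and cut-off types and every norm functional ((3.39)–(3.41)) unchanged. [cite: Balaban1985BackgroundPropagators, (3.39)–(3.42) p.397 («x ∈ Δ(y), y ∈ Λ_j, supp λ ⊂ Δ(y′)»); Balaban1984PropagatorsII, (2.3) p.224, (2.45) p.231] -/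
def comapGeo : Geometry where
  Site := S
  scale := fun a => g.scale (φ a)
  dist := fun a a' => g.dist (φ a) (φ a')
  k := g.k
  eta := g.eta
  L := g.L
  M := g.M
  Loc := g.Loc
  suppIn := fun lam a => g.suppIn lam (φ a)
  suppInT := fun lam a => g.suppInT lam (φ a)
  supNorm := g.supNorm
  l2Norm := g.l2Norm
  wNorm := g.wNorm
  holder := g.holder
  Cut := g.Cut
  cutIn := fun ζ a => g.cutIn ζ (φ a)
  cutInT := fun ζ a => g.cutInT ζ (φ a)
  cutH := g.cutH
  cutSup := g.cutSup
  suppInT_of_suppIn := fun lam a h => g.suppInT_of_suppIn lam (φ a) h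
  cutInT_of_cutIn := fun ζ a h => g.cutInT_of_cutIn ζ (φ a) h

/-- the scale length of a re-indexed site is that of its image: `(L^{scale}η)(a) = (L^{scale}η)(φ a)`. [cite: Balaban1985BackgroundPropagators, (3.41) p.397, dictionary] -/
theorem comapGeo_len (a : S) : (comapGeo g φ).len a = g.len (φ a) := rfl

/-- the `M`-field is unchanged by re-indexing. [cite: Balaban1985BackgroundPropagators, Thm 3.1 p.397 («for M ≥ M₁»), dictionary] -/
theorem comapGeo_M : (comapGeo g φ).M = g.M := rfl

variable {g} {B : Backgrounds}

/-- **A KERNEL FAMILY RE-INDEXED ALONG `φ`**: the localised entries `e` (3.42), `e4` (3.44) read at the image site; the cut-off entries `h1`, `h2`,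
`l2` and the global entries `glob` (no site argument) unchanged. [cite: Balaban1985BackgroundPropagators, (3.42)–(3.47) pp.397–398] -/
def comapK (K : KernelFamily g B) : KernelFamily (comapGeo g φ) B where
  e := fun n U lam a => K.e n U lam (φ a)
  h1 := K.h1
  e4 := fun U lam a => K.e4 U lam (φ a)
  h2 := K.h2
  l2 := K.l2
  glob := K.glob

/-- **A TWO-POINT KERNEL RE-INDEXED ALONG `φ`** ((3.48): `K(a, a′) := K(φ a, φ a′)`). [cite: Balaban1985BackgroundPropagators, (3.48) p.398] -/
def comapSK (C : SiteKernel g B) : SiteKernel (comapGeo g φ) B := ⟨fun U a a' => C.ker U (φ a) (φ a')⟩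

/-- entries of the re-indexed family, by `rfl`. [cite: Balaban1985BackgroundPropagators, (3.42) p.397, dictionary] -/
theorem comapK_e (K : KernelFamily g B) (n : Fin 4) (U : B.Cfg) (lam : g.Loc) (a : S) : (comapK φ K).e n U lam a = K.e n U lam (φ a) := rfl

/-- entries of the re-indexed kernel, by `rfl`. [cite: Balaban1985BackgroundPropagators, (3.48) p.398, dictionary] -/
theorem comapSK_ker (C : SiteKernel g B) (U : B.Cfg) (a a' : S) : (comapSK φ C).ker U a a' = C.ker U (φ a) (φ a') := rfl

end Comap

/-! ## §2 Restriction: the blocks of Theorems 3.1–3.3 pass to the pulled-back reading with the same constants -/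

section Restrict

variable {g : Geometry} {B : Backgrounds} {S : Type} (φ : S → g.Site)

/-- **(3.42) + (3.46) + (3.47) RESTRICT along `φ`** (same constants). [cite: Balaban1985BackgroundPropagators, (3.42) + (3.46) + (3.47) pp.397–398] -/
theorem ineq342_346_347_comap (K : KernelFamily g B) {B₀ δ₀ : ℝ} {U : B.Cfg} (h : Ineq342_346_347 K B₀ δ₀ U) :
    Ineq342_346_347 (comapK φ K) B₀ δ₀ U :=
  ⟨fun n lam a a' hs => h.1 n lam (φ a) (φ a') hs, fun n lam hh a a' hc hs => h.2.1 n lam hh (φ a) (φ a') hc hs, h.2.2⟩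

/-- **(3.43)–(3.45) RESTRICT along `φ`** (same constants). [cite: Balaban1985BackgroundPropagators, (3.43)–(3.45) p.398] -/
theorem ineq343_345_comap (K : KernelFamily g B) {Bβ Bε : ℝ → ℝ} {Bεβ : ℝ → ℝ → ℝ} {δ₀ : ℝ} {U : B.Cfg}
    (h : Ineq343_345 K Bβ Bε Bεβ δ₀ U) : Ineq343_345 (comapK φ K) Bβ Bε Bεβ δ₀ U :=
  ⟨fun β lam ζ a a' h0 h1 hζ hs => h.1 β lam ζ (φ a) (φ a') h0 h1 hζ hs,
    fun ε lam a a' h0 h1 hs => h.2.1 ε lam (φ a) (φ a') h0 h1 hs,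
    fun ε β lam ζ a a' h0 h1 h2 h3 hζ hs => h.2.2 ε β lam ζ (φ a) (φ a') h0 h1 h2 h3 hζ hs⟩

/-- **(3.48) RESTRICTS along `φ`** (same constants). [cite: Balaban1985BackgroundPropagators, (3.48) p.398] -/
theorem cinv348_comap (d : ℕ) (C : SiteKernel g B) {B₁ δ₁ : ℝ} {U : B.Cfg}
    (h : ∀ y y' : g.Site, |C.ker U y y'| ≤ B₁ * (g.len y) ^ (-(4 : ℝ)) * (g.len y') ^ (-(d : ℝ)) * Real.exp (-(δ₁ * g.dist y y'))) :
    ∀ a a' : S, |(comapSK φ C).ker U a a'| ≤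
      B₁ * ((comapGeo g φ).len a) ^ (-(4 : ℝ)) * ((comapGeo g φ).len a') ^ (-(d : ℝ)) * Real.exp (-(δ₁ * (comapGeo g φ).dist a a')) :=
  fun a a' => h (φ a) (φ a')

/-- ★ **«THE INEQUALITIES OF THEOREMS 3.1–3.3 HOLD AT `U`» RESTRICTS along `φ`** for all three operators at once, same constants.
[cite: Balaban1985BackgroundPropagators, Thms 3.1–3.3 pp.397–399] -/
theorem thms31to33IneqAt_comap (d : ℕ) (Gp GA : KernelFamily g B) (Cinv : SiteKernel g B) {B₀ δ₀ : ℝ} {Bβ Bε : ℝ → ℝ} {Bεβ : ℝ → ℝ → ℝ}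
    {B₁ δ₁ : ℝ} {U : B.Cfg} (h : Thms31to33IneqAt d Gp GA Cinv B₀ δ₀ Bβ Bε Bεβ B₁ δ₁ U) :
    Thms31to33IneqAt d (comapK φ Gp) (comapK φ GA) (comapSK φ Cinv) B₀ δ₀ Bβ Bε Bεβ B₁ δ₁ U :=
  ⟨⟨ineq342_346_347_comap φ Gp h.1.1, ineq343_345_comap φ Gp h.1.2⟩, cinv348_comap φ d Cinv h.2.1,
    ⟨ineq342_346_347_comap φ GA h.2.2.1, ineq343_345_comap φ GA h.2.2.2⟩⟩

end Restrict

/-! ## §3 The converse on `range φ`; the orphan law for the sites off `range φ` -/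

section Converse

variable {g : Geometry} {B : Backgrounds} {S : Type} (φ : S → g.Site)

/-- **(3.42) + (3.46) ON THE SITE PAIRS WITH AN END OFF `range φ`** — the «orphan law» shape: the clauses of `Ineq342_346_347` that a pulled-back
reading cannot see ((3.47) has no site argument and is not repeated). [cite: Balaban1985BackgroundPropagators, (3.42) + (3.46) pp.397–398 («y, y′ ∈ 𝔅»)] -/
def Ineq342_346_347Off (K : KernelFamily g B) (B₀ δ₀ : ℝ) (U : B.Cfg) : Prop :=
  (∀ (n : Fin 4) (lam : g.Loc) (y y' : g.Site), (y ∉ Set.range φ ∨ y' ∉ Set.range φ) → g.suppIn lam y' →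
      K.e n U lam y ≤ B₀ * pref4 (g.len y) n * Real.exp (-(δ₀ * g.dist y y')) * g.supNorm lam) ∧
  (∀ (n : Fin 6) (lam : g.Loc) (h : g.Cut) (y y' : g.Site), (y ∉ Set.range φ ∨ y' ∉ Set.range φ) → g.cutIn h y → g.suppIn lam y' →
      K.l2 n U lam h ≤ B₀ * pref6 (g.len y) n * g.cutSup h * Real.exp (-(δ₀ * g.dist y y')) * g.l2Norm lam)

/-- **(3.43)–(3.45) ON THE SITE PAIRS WITH AN END OFF `range φ`**. [cite: Balaban1985BackgroundPropagators, (3.43)–(3.45) p.398 («y ∈ Λ_j, … y′ ∈ Λ_{j′}»)] -/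
def Ineq343_345Off (K : KernelFamily g B) (Bβ Bε : ℝ → ℝ) (Bεβ : ℝ → ℝ → ℝ) (δ₀ : ℝ) (U : B.Cfg) : Prop :=
  (∀ (β : ℝ) (lam : g.Loc) (ζ : g.Cut) (y y' : g.Site), (y ∉ Set.range φ ∨ y' ∉ Set.range φ) → 0 ≤ β → β < 1 → g.cutInT ζ y →
      g.suppIn lam y' →
      K.h1 U lam β ζ ≤ Bβ β * (g.len y) ^ (1 - β) * g.cutH β ζ * Real.exp (-(δ₀ * g.dist y y')) * g.supNorm lam) ∧
  (∀ (ε : ℝ) (lam : g.Loc) (y y' : g.Site), (y ∉ Set.range φ ∨ y' ∉ Set.range φ) → 0 < ε → ε ≤ 1 → g.suppInT lam y' →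
      K.e4 U lam y ≤ Bε ε * Real.exp (-(δ₀ * g.dist y y')) * (g.holder ε lam + g.supNorm lam)) ∧
  (∀ (ε β : ℝ) (lam : g.Loc) (ζ : g.Cut) (y y' : g.Site), (y ∉ Set.range φ ∨ y' ∉ Set.range φ) → 0 < ε → ε ≤ 1 → 0 ≤ β → β < 1 →
      g.cutInT ζ y → g.suppInT lam y' →
      K.h2 U lam β ζ ≤ Bεβ ε β * (g.len y) ^ (-β) * g.cutH β ζ * Real.exp (-(δ₀ * g.dist y y')) *
        (g.holder (β + ε) lam + g.supNorm lam))

/-- **(3.48) ON THE SITE PAIRS WITH AN END OFF `range φ`**. [cite: Balaban1985BackgroundPropagators, (3.48) p.398 («y, y′ ∈ 𝔅»)] -/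
def Cinv348Off (d : ℕ) (C : SiteKernel g B) (B₁ δ₁ : ℝ) (U : B.Cfg) : Prop :=
  ∀ y y' : g.Site, (y ∉ Set.range φ ∨ y' ∉ Set.range φ) →
    |C.ker U y y'| ≤ B₁ * (g.len y) ^ (-(4 : ℝ)) * (g.len y') ^ (-(d : ℝ)) * Real.exp (-(δ₁ * g.dist y y'))

/-- **«THEOREMS 3.1–3.3 AT `U`» ON THE SITE PAIRS WITH AN END OFF `range φ`** — the orphan law for all three operators.
[cite: Balaban1985BackgroundPropagators, Thms 3.1–3.3 pp.397–399] -/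
def Thms31to33IneqOff (d : ℕ) (Gp GA : KernelFamily g B) (Cinv : SiteKernel g B) (B₀ δ₀ : ℝ) (Bβ Bε : ℝ → ℝ) (Bεβ : ℝ → ℝ → ℝ)
    (B₁ δ₁ : ℝ) (U : B.Cfg) : Prop :=
  (Ineq342_346_347Off φ Gp B₀ δ₀ U ∧ Ineq343_345Off φ Gp Bβ Bε Bεβ δ₀ U) ∧ Cinv348Off φ d Cinv B₁ δ₁ U ∧
  (Ineq342_346_347Off φ GA B₀ δ₀ U ∧ Ineq343_345Off φ GA Bβ Bε Bεβ δ₀ U)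

/-- a site pair is either inside `range φ × range φ` (with chosen preimages) or has an end off `range φ`. [folklore] [cite: Balaban1984PropagatorsII, (2.3) p.224, bookkeeping] -/
theorem pair_cases (y y' : g.Site) :
    (∃ a a' : S, φ a = y ∧ φ a' = y') ∨ (y ∉ Set.range φ ∨ y' ∉ Set.range φ) := by
  classical
  by_cases hy : y ∈ Set.range φ
  · by_cases hy' : y' ∈ Set.range φ
    · obtain ⟨a, ha⟩ := hy
      obtain ⟨a', ha'⟩ := hy'
      exact Or.inl ⟨a, a', ha, ha'⟩
    · exact Or.inr (Or.inr hy')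
  · exact Or.inr (Or.inl hy)

/-- **(3.42) + (3.46) + (3.47) FROM THE PULLED-BACK READING AND THE ORPHAN LAW** (same constants on both parts).
[cite: Balaban1985BackgroundPropagators, (3.42) + (3.46) + (3.47) pp.397–398] -/
theorem ineq342_346_347_of_comap_of_off (K : KernelFamily g B) {B₀ δ₀ : ℝ} {U : B.Cfg}
    (h : Ineq342_346_347 (comapK φ K) B₀ δ₀ U) (ho : Ineq342_346_347Off φ K B₀ δ₀ U) : Ineq342_346_347 K B₀ δ₀ U := by
  refine ⟨fun n lam y y' hs => ?_, fun n lam hh y y' hc hs => ?_, h.2.2⟩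
  · rcases pair_cases φ y y' with ⟨a, a', rfl, rfl⟩ | hoff
    · exact h.1 n lam a a' hs
    · exact ho.1 n lam y y' hoff hs
  · rcases pair_cases φ y y' with ⟨a, a', rfl, rfl⟩ | hoff
    · exact h.2.1 n lam hh a a' hc hs
    · exact ho.2 n lam hh y y' hoff hc hs

/-- **(3.43)–(3.45) FROM THE PULLED-BACK READING AND THE ORPHAN LAW**. [cite: Balaban1985BackgroundPropagators, (3.43)–(3.45) p.398] -/
theorem ineq343_345_of_comap_of_off (K : KernelFamily g B) {Bβ Bε : ℝ → ℝ} {Bεβ : ℝ → ℝ → ℝ} {δ₀ : ℝ} {U : B.Cfg}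
    (h : Ineq343_345 (comapK φ K) Bβ Bε Bεβ δ₀ U) (ho : Ineq343_345Off φ K Bβ Bε Bεβ δ₀ U) : Ineq343_345 K Bβ Bε Bεβ δ₀ U := by
  refine ⟨fun β lam ζ y y' h0 h1 hζ hs => ?_, fun ε lam y y' h0 h1 hs => ?_, fun ε β lam ζ y y' h0 h1 h2 h3 hζ hs => ?_⟩
  · rcases pair_cases φ y y' with ⟨a, a', rfl, rfl⟩ | hoff
    · exact h.1 β lam ζ a a' h0 h1 hζ hs
    · exact ho.1 β lam ζ y y' hoff h0 h1 hζ hs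
  · rcases pair_cases φ y y' with ⟨a, a', rfl, rfl⟩ | hoff
    · exact h.2.1 ε lam a a' h0 h1 hs
    · exact ho.2.1 ε lam y y' hoff h0 h1 hs
  · rcases pair_cases φ y y' with ⟨a, a', rfl, rfl⟩ | hoff
    · exact h.2.2 ε β lam ζ a a' h0 h1 h2 h3 hζ hs
    · exact ho.2.2 ε β lam ζ y y' hoff h0 h1 h2 h3 hζ hs

/-- **(3.48) FROM THE PULLED-BACK KERNEL AND THE ORPHAN LAW**. [cite: Balaban1985BackgroundPropagators, (3.48) p.398] -/
theorem cinv348_of_comap_of_off (d : ℕ) (C : SiteKernel g B) {B₁ δ₁ : ℝ} {U : B.Cfg}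
    (h : ∀ a a' : S, |(comapSK φ C).ker U a a'| ≤
      B₁ * ((comapGeo g φ).len a) ^ (-(4 : ℝ)) * ((comapGeo g φ).len a') ^ (-(d : ℝ)) * Real.exp (-(δ₁ * (comapGeo g φ).dist a a')))
    (ho : Cinv348Off φ d C B₁ δ₁ U) :
    ∀ y y' : g.Site, |C.ker U y y'| ≤ B₁ * (g.len y) ^ (-(4 : ℝ)) * (g.len y') ^ (-(d : ℝ)) * Real.exp (-(δ₁ * g.dist y y')) := by
  intro y y'
  rcases pair_cases φ y y' with ⟨a, a', rfl, rfl⟩ | hoff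
  · exact h a a'
  · exact ho y y' hoff

/-- ★ **«THEOREMS 3.1–3.3 AT `U`» FROM THE PULLED-BACK READING AND THE ORPHAN LAW** (same constants on both parts: a common constant tuple is
first obtained at a concrete geometry by weakening, where the sign facts are known). [cite: Balaban1985BackgroundPropagators, Thms 3.1–3.3 pp.397–399] -/
theorem thms31to33IneqAt_of_comap_of_off (d : ℕ) (Gp GA : KernelFamily g B) (Cinv : SiteKernel g B) {B₀ δ₀ : ℝ} {Bβ Bε : ℝ → ℝ}
    {Bεβ : ℝ → ℝ → ℝ} {B₁ δ₁ : ℝ} {U : B.Cfg}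
    (h : Thms31to33IneqAt d (comapK φ Gp) (comapK φ GA) (comapSK φ Cinv) B₀ δ₀ Bβ Bε Bεβ B₁ δ₁ U)
    (ho : Thms31to33IneqOff φ d Gp GA Cinv B₀ δ₀ Bβ Bε Bεβ B₁ δ₁ U) :
    Thms31to33IneqAt d Gp GA Cinv B₀ δ₀ Bβ Bε Bεβ B₁ δ₁ U :=
  ⟨⟨ineq342_346_347_of_comap_of_off φ Gp h.1.1 ho.1.1, ineq343_345_of_comap_of_off φ Gp h.1.2 ho.1.2⟩,
    cinv348_of_comap_of_off φ d Cinv h.2.1 ho.2.1,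
    ⟨ineq342_346_347_of_comap_of_off φ GA h.2.2.1 ho.2.2.1, ineq343_345_of_comap_of_off φ GA h.2.2.2 ho.2.2.2⟩⟩

/-- **WHEN `φ` IS ONTO, THE ORPHAN LAW IS VACUOUS** (there are no sites off `range φ`). [cite: Balaban1984PropagatorsII, (2.3) p.224, (2.45) p.231, bookkeeping] -/
theorem thms31to33IneqOff_of_surjective (hφ : Function.Surjective φ) (d : ℕ) (Gp GA : KernelFamily g B) (Cinv : SiteKernel g B) (B₀ δ₀ : ℝ)
    (Bβ Bε : ℝ → ℝ) (Bεβ : ℝ → ℝ → ℝ) (B₁ δ₁ : ℝ) (U : B.Cfg) : Thms31to33IneqOff φ d Gp GA Cinv B₀ δ₀ Bβ Bε Bεβ B₁ δ₁ U := by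
  have hno : ∀ y y' : g.Site, ¬ (y ∉ Set.range φ ∨ y' ∉ Set.range φ) := fun y y' h =>
    h.elim (fun hy => hy (hφ.range_eq ▸ Set.mem_univ y)) (fun hy' => hy' (hφ.range_eq ▸ Set.mem_univ y'))
  exact ⟨⟨⟨fun n lam y y' hoff => (hno y y' hoff).elim, fun n lam hh y y' hoff => (hno y y' hoff).elim⟩,
      ⟨fun β lam ζ y y' hoff => (hno y y' hoff).elim, fun ε lam y y' hoff => (hno y y' hoff).elim,
        fun ε β lam ζ y y' hoff => (hno y y' hoff).elim⟩⟩,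
    fun y y' hoff => (hno y y' hoff).elim,
    ⟨⟨fun n lam y y' hoff => (hno y y' hoff).elim, fun n lam hh y y' hoff => (hno y y' hoff).elim⟩,
      ⟨fun β lam ζ y y' hoff => (hno y y' hoff).elim, fun ε lam y y' hoff => (hno y y' hoff).elim,
        fun ε β lam ζ y y' hoff => (hno y y' hoff).elim⟩⟩⟩

/-- **WHEN `φ` IS ONTO, THE BLOCKS OF THE READING AND OF ITS PULL-BACK ARE EQUIVALENT** (same constants).
[cite: Balaban1985BackgroundPropagators, Thms 3.1–3.3 pp.397–399] -/
theorem thms31to33IneqAt_of_comap_surjective (hφ : Function.Surjective φ) (d : ℕ) (Gp GA : KernelFamily g B) (Cinv : SiteKernel g B)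
    {B₀ δ₀ : ℝ} {Bβ Bε : ℝ → ℝ} {Bεβ : ℝ → ℝ → ℝ} {B₁ δ₁ : ℝ} {U : B.Cfg}
    (h : Thms31to33IneqAt d (comapK φ Gp) (comapK φ GA) (comapSK φ Cinv) B₀ δ₀ Bβ Bε Bεβ B₁ δ₁ U) :
    Thms31to33IneqAt d Gp GA Cinv B₀ δ₀ Bβ Bε Bεβ B₁ δ₁ U :=
  thms31to33IneqAt_of_comap_of_off φ d Gp GA Cinv h (thms31to33IneqOff_of_surjective φ hφ d Gp GA Cinv B₀ δ₀ Bβ Bε Bεβ B₁ δ₁ U)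

end Converse

/-! ## §4 The Sect.-B step across two readings on two geometries; restriction along an index map -/

section Transfer

variable {I : Type} (d : ℕ) (c35 : ℝ) (geo₁ geo₂ : I → Geometry) (bg : I → Backgrounds)
  (Gp₁ GA₁ : ∀ i, KernelFamily (geo₁ i) (bg i)) (Cinv₁ : ∀ i, SiteKernel (geo₁ i) (bg i))
  (Gp₂ GA₂ : ∀ i, KernelFamily (geo₂ i) (bg i)) (Cinv₂ : ∀ i, SiteKernel (geo₂ i) (bg i))
  (IsAn₁ : ∀ i, KernelFamily (geo₁ i) (bg i) → (bg i).Cfg → ℝ → Prop)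
  (IsAn₂ : ∀ i, KernelFamily (geo₂ i) (bg i) → (bg i).Cfg → ℝ → Prop)

/-- ★★ **THE SECT.-B STEP TRANSFERS BETWEEN TWO READINGS ON TWO GEOMETRIES WITH THE SAME `M`-FIELD** («of course with different constants»,
p. 403).  Reading 1 lives on `geo₁`, reading 2 on `geo₂`, same backgrounds; `hM`: the members' `M` agree.  `hin`: at every (3.35)-regular `U` (above a
threshold, `Mα₀` small) the Theorem-3.1∕3.3 blocks of reading 2 with constants `t` (of any sign) give those of reading 1 with constants `t′(t)`.
`hout`: for every constant tuple `t′` and cap `a > 0` there are a cap `0 < a′ ≦ a`, a threshold and constants `t″` such that at every product `U′U`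
(`U` regular above the threshold, `U′` in (3.37) at `0 < α₁ ≦ a′`) the blocks of reading 1 with `t′` give those of reading 2 with `t″`.  `hAn`:
analyticity of reading 1 gives analyticity of reading 2.  Then the step for reading 1 gives the step for reading 2.
[cite: Balaban1985BackgroundPropagators, Thm 3.4 p.400, p.403 l.1–9, (3.35)–(3.37) p.396] -/
theorem sectBStepPrinted_of_readings (hM : ∀ i, (geo₂ i).M = (geo₁ i).M)
    (hin : ∀ (B₀ δ₀ : ℝ) (Bβ Bε : ℝ → ℝ) (Bεβ : ℝ → ℝ → ℝ) (B₁ δ₁ : ℝ),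
      ∃ (Mi ai B₀' δ₀' : ℝ) (Bβ' Bε' : ℝ → ℝ) (Bεβ' : ℝ → ℝ → ℝ) (B₁' δ₁' : ℝ), 0 < ai ∧
        ∀ i : I, Mi ≤ (geo₁ i).M → ∀ α₀ : ℝ, 0 < α₀ → (geo₁ i).M * α₀ ≤ ai → ∀ U : (bg i).Cfg, (bg i).Reg335 c35 α₀ U →
          Thms31to33IneqAt d (Gp₂ i) (GA₂ i) (Cinv₂ i) B₀ δ₀ Bβ Bε Bεβ B₁ δ₁ U →
          Thms31to33IneqAt d (Gp₁ i) (GA₁ i) (Cinv₁ i) B₀' δ₀' Bβ' Bε' Bεβ' B₁' δ₁' U)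
    (hout : ∀ (B₀ δ₀ : ℝ) (Bβ Bε : ℝ → ℝ) (Bεβ : ℝ → ℝ → ℝ) (B₁ δ₁ : ℝ) (a : ℝ), 0 < B₀ → 0 < δ₀ → 0 < B₁ → 0 < δ₁ → 0 < a →
      ∃ (Mo ao a' B₀' δ₀' : ℝ) (Bβ' Bε' : ℝ → ℝ) (Bεβ' : ℝ → ℝ → ℝ) (B₁' δ₁' : ℝ), 0 < ao ∧ 0 < a' ∧ a' ≤ a ∧ 0 < B₀' ∧ 0 < δ₀' ∧ 0 < B₁' ∧ 0 < δ₁' ∧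
        ∀ i : I, Mo ≤ (geo₁ i).M → ∀ α₀ : ℝ, 0 < α₀ → (geo₁ i).M * α₀ ≤ ao → ∀ U : (bg i).Cfg, (bg i).Reg335 c35 α₀ U →
          ∀ α₁ : ℝ, 0 < α₁ → α₁ ≤ a' → ∀ U' : (bg i).Cfg, (bg i).Cplx337 α₁ U U' →
          Thms31to33IneqAt d (Gp₁ i) (GA₁ i) (Cinv₁ i) B₀ δ₀ Bβ Bε Bεβ B₁ δ₁ ((bg i).mul U' U) →
          Thms31to33IneqAt d (Gp₂ i) (GA₂ i) (Cinv₂ i) B₀' δ₀' Bβ' Bε' Bεβ' B₁' δ₁' ((bg i).mul U' U))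
    (hAn : ∀ i (U : (bg i).Cfg) (α : ℝ), (IsAn₁ i (Gp₁ i) U α → IsAn₂ i (Gp₂ i) U α) ∧ (IsAn₁ i (GA₁ i) U α → IsAn₂ i (GA₂ i) U α))
    (h : SectBStepPrinted d c35 geo₁ bg Gp₁ GA₁ Cinv₁ IsAn₁) :
    SectBStepPrinted d c35 geo₂ bg Gp₂ GA₂ Cinv₂ IsAn₂ := by
  intro B₀ δ₀ Bβ Bε Bεβ B₁ δ₁
  obtain ⟨Mi, ai, B₀i, δ₀i, Bβi, Bεi, Bεβi, B₁i, δ₁i, hai, Hin⟩ := hin B₀ δ₀ Bβ Bε Bεβ B₁ δ₁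
  obtain ⟨M₀, a₁, a₀', B₀', δ₀', Bβ', Bε', Bεβ', B₁', δ₁', hM₀, ha₁, ha₀', hB₀', hδ₀', hB₁', hδ₁', H⟩ := h B₀i δ₀i Bβi Bεi Bεβi B₁i δ₁i
  obtain ⟨Mo, ao, a', B₀o, δ₀o, Bβo, Bεo, Bεβo, B₁o, δ₁o, hao, ha', ha'a, hB₀o, hδ₀o, hB₁o, hδ₁o, Hout⟩ :=
    hout B₀' δ₀' Bβ' Bε' Bεβ' B₁' δ₁' a₁ hB₀' hδ₀' hB₁' hδ₁' ha₁
  refine ⟨max M₀ (max Mi Mo), a', min a₀' (min ai ao), B₀o, δ₀o, Bβo, Bεo, Bεβo, B₁o, δ₁o,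
    lt_max_of_lt_left hM₀, ha', lt_min ha₀' (lt_min hai hao), hB₀o, hδ₀o, hB₁o, hδ₁o, fun i hM2 α₀ hα₀ hMa2 U hU hT α₁ hα₁ hα₁a => ?_⟩
  have hMeq := hM i
  have hM1 : max M₀ (max Mi Mo) ≤ (geo₁ i).M := hMeq ▸ hM2
  have hMa : (geo₁ i).M * α₀ ≤ min a₀' (min ai ao) := hMeq ▸ hMa2
  have hM0 : M₀ ≤ (geo₁ i).M := le_trans (le_max_left _ _) hM1
  have hMi : Mi ≤ (geo₁ i).M := le_trans (le_trans (le_max_left _ _) (le_max_right _ _)) hM1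
  have hMo : Mo ≤ (geo₁ i).M := le_trans (le_trans (le_max_right _ _) (le_max_right _ _)) hM1
  have ha0 : (geo₁ i).M * α₀ ≤ a₀' := le_trans hMa (min_le_left _ _)
  have hai' : (geo₁ i).M * α₀ ≤ ai := le_trans hMa (le_trans (min_le_right _ _) (min_le_left _ _))
  have hao' : (geo₁ i).M * α₀ ≤ ao := le_trans hMa (le_trans (min_le_right _ _) (min_le_right _ _))
  have hT₁ := Hin i hMi α₀ hα₀ hai' U hU hT
  obtain ⟨hAp, hAA, Hprod⟩ := H i hM0 α₀ hα₀ ha0 U hU hT₁ α₁ hα₁ (le_trans hα₁a ha'a)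
  refine ⟨(hAn i U α₁).1 hAp, (hAn i U α₁).2 hAA, fun U' hU' => ?_⟩
  exact Hout i hMo α₀ hα₀ hao' U hU α₁ hα₁ hα₁a U' hU' (Hprod U' hU')

/-- **THE SECT.-B STEP RESTRICTS ALONG ANY MAP OF MEMBER INDICES** `f : J → I` (a family statement with uniform constants restricts to every
sub-family). [cite: Balaban1985BackgroundPropagators, Sect. B p.400 (the family of backgrounds), bookkeeping] -/
theorem sectBStepPrinted_restrict {J : Type} (f : J → I) (geo : I → Geometry) (Gp GA : ∀ i, KernelFamily (geo i) (bg i))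
    (Cinv : ∀ i, SiteKernel (geo i) (bg i)) (IsAn : ∀ i, KernelFamily (geo i) (bg i) → (bg i).Cfg → ℝ → Prop)
    (h : SectBStepPrinted d c35 geo bg Gp GA Cinv IsAn) :
    SectBStepPrinted d c35 (fun j => geo (f j)) (fun j => bg (f j)) (fun j => Gp (f j)) (fun j => GA (f j)) (fun j => Cinv (f j))
      (fun j => IsAn (f j)) := by
  intro B₀ δ₀ Bβ Bε Bεβ B₁ δ₁
  obtain ⟨M₀, a₁, a₀', B₀', δ₀', Bβ', Bε', Bεβ', B₁', δ₁', hM₀, ha₁, ha₀', hB₀', hδ₀', hB₁', hδ₁', H⟩ := h B₀ δ₀ Bβ Bε Bεβ B₁ δ₁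
  exact ⟨M₀, a₁, a₀', B₀', δ₀', Bβ', Bε', Bεβ', B₁', δ₁', hM₀, ha₁, ha₀', hB₀', hδ₀', hB₁', hδ₁', fun j => H (f j)⟩

end Transfer

/-! ## §5 The step for a pulled-back reading: from the step of the reading and the lift law at regular `U` -/

section ComapStep

variable {I : Type} (d : ℕ) (c35 : ℝ) (geo : I → Geometry) (bg : I → Backgrounds) {S : I → Type} (φ : ∀ i, S i → (geo i).Site)
  (Gp GA : ∀ i, KernelFamily (geo i) (bg i)) (Cinv : ∀ i, SiteKernel (geo i) (bg i))
  (IsAn : ∀ i, KernelFamily (geo i) (bg i) → (bg i).Cfg → ℝ → Prop)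
  (IsAn' : ∀ i, KernelFamily (comapGeo (geo i) (φ i)) (bg i) → (bg i).Cfg → ℝ → Prop)

/-- ★★ **THE STEP FOR THE PULLED-BACK READING FROM THE STEP OF THE READING AND THE LIFT LAW.**  `h`: the Sect.-B step for `(geo, Gp, GA, Cinv)`.
`hlift` (DISPLAYED): at every regular `U` above a threshold the Theorem-3.1∕3.3 blocks of the pulled-back reading with constants `t` give the blocks of
the reading with constants `t′(t)` — by §3 this is exactly the ORPHAN LAW on the site pairs with an end off `range φ` (plus a weakening to common
constants), vacuous when `φ` is onto.  `hAn`: analyticity passes to the pulled-back families.  Then the step holds for the pulled-back reading; the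
output side is the restriction §2 with unchanged constants. [cite: Balaban1985BackgroundPropagators, Thm 3.4 p.400, Sect. B pp.400–407, (3.42) p.397 («y, y′ ∈ 𝔅»)] -/
theorem sectBStepPrinted_comap_of_liftLaw
    (hlift : ∀ (B₀ δ₀ : ℝ) (Bβ Bε : ℝ → ℝ) (Bεβ : ℝ → ℝ → ℝ) (B₁ δ₁ : ℝ),
      ∃ (Mi ai B₀' δ₀' : ℝ) (Bβ' Bε' : ℝ → ℝ) (Bεβ' : ℝ → ℝ → ℝ) (B₁' δ₁' : ℝ), 0 < ai ∧
        ∀ i : I, Mi ≤ (geo i).M → ∀ α₀ : ℝ, 0 < α₀ → (geo i).M * α₀ ≤ ai → ∀ U : (bg i).Cfg, (bg i).Reg335 c35 α₀ U →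
          Thms31to33IneqAt d (comapK (φ i) (Gp i)) (comapK (φ i) (GA i)) (comapSK (φ i) (Cinv i)) B₀ δ₀ Bβ Bε Bεβ B₁ δ₁ U →
          Thms31to33IneqAt d (Gp i) (GA i) (Cinv i) B₀' δ₀' Bβ' Bε' Bεβ' B₁' δ₁' U)
    (hAn : ∀ i (U : (bg i).Cfg) (α : ℝ), (IsAn i (Gp i) U α → IsAn' i (comapK (φ i) (Gp i)) U α) ∧
      (IsAn i (GA i) U α → IsAn' i (comapK (φ i) (GA i)) U α))
    (h : SectBStepPrinted d c35 geo bg Gp GA Cinv IsAn) :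
    SectBStepPrinted d c35 (fun i => comapGeo (geo i) (φ i)) bg (fun i => comapK (φ i) (Gp i)) (fun i => comapK (φ i) (GA i))
      (fun i => comapSK (φ i) (Cinv i)) IsAn' := by
  refine sectBStepPrinted_of_readings d c35 geo (fun i => comapGeo (geo i) (φ i)) bg Gp GA Cinv
    (fun i => comapK (φ i) (Gp i)) (fun i => comapK (φ i) (GA i)) (fun i => comapSK (φ i) (Cinv i)) IsAn IsAn' (fun _ => rfl) hlift ?_ hAn h
  intro B₀ δ₀ Bβ Bε Bεβ B₁ δ₁ a hB₀ hδ₀ hB₁ hδ₁ ha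
  exact ⟨0, 1, a, B₀, δ₀, Bβ, Bε, Bεβ, B₁, δ₁, one_pos, ha, le_rfl, hB₀, hδ₀, hB₁, hδ₁,
    fun i _ _ _ _ _ _ _ _ _ _ _ hT => thms31to33IneqAt_comap (φ i) d (Gp i) (GA i) (Cinv i) hT⟩

/-- ★ **WHEN EVERY `φ i` IS ONTO, THE PULLED-BACK READING INHERITS THE STEP WITH NO LAW.**
[cite: Balaban1985BackgroundPropagators, Thm 3.4 p.400, Sect. B pp.400–407] -/
theorem sectBStepPrinted_comap_of_surjective (hφ : ∀ i, Function.Surjective (φ i))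
    (hAn : ∀ i (U : (bg i).Cfg) (α : ℝ), (IsAn i (Gp i) U α → IsAn' i (comapK (φ i) (Gp i)) U α) ∧
      (IsAn i (GA i) U α → IsAn' i (comapK (φ i) (GA i)) U α))
    (h : SectBStepPrinted d c35 geo bg Gp GA Cinv IsAn) :
    SectBStepPrinted d c35 (fun i => comapGeo (geo i) (φ i)) bg (fun i => comapK (φ i) (Gp i)) (fun i => comapK (φ i) (GA i))
      (fun i => comapSK (φ i) (Cinv i)) IsAn' :=
  sectBStepPrinted_comap_of_liftLaw d c35 geo bg φ Gp GA Cinv IsAn IsAn'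
    (fun B₀ δ₀ Bβ Bε Bεβ B₁ δ₁ => ⟨0, 1, B₀, δ₀, Bβ, Bε, Bεβ, B₁, δ₁, one_pos,
      fun i _ _ _ _ _ _ hT => thms31to33IneqAt_of_comap_surjective (φ i) (hφ i) d (Gp i) (GA i) (Cinv i) hT⟩) hAn h

end ComapStep

end Literature.MathematicalPhysics.QuantumFieldTheory.Balaban1983to89.B9SectBStepReadingMaps
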